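import Literature.AlgebraicGeometry.Shioda1979.Statement
import Literature.AlgebraicGeometry.Shioda1982.ExceptionalQuadruplesComplete
import HarnessLib

/-!
# Obstructions to Shioda's stable-generation condition `(Q⁴ₘ)`: additive functionals vanishing on `M'ₘ` — the search

HONEST FRAMING: explicit algebraic cycles for specific Hodge classes on Fermat/Delsarte varieties;
residual open instances listed; no claim on general Hodge.

Topic path `Summits/HodgeConjecture/FermatCycles/` of cell `pub-hfermat` (new work, not literature: the tool certifying the FALSE entries of
the cell's `(Q⁴ₘ)` table, `pub-hfermat-enum/P4-TABLE.md` §(Q⁴ₘ)). Companion of `ConditionQFourfold*.lean` (the TRUE entries) and of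
`Literature/AlgebraicGeometry/Shioda1981/ConditionQTwentyFive.lean` (Shioda's own negative instance `m = 25`, whose printed proof this file
generalises: there the functional is "symmetric multiplicities").

THE METHOD. `(Q⁴ₘ)` ([Shioda1979HodgeFermat] §4 p. 183; tree `Shioda1979.ConditionQ m 4`) asks that every Hodge sextuple `s` over `ℤ/m` be
`ξ₁ − ξ₂` with `ξ₁, ξ₂ ∈ M'ₘ = ⟨pairs, Hodge 4-multisets, semi-decomposable Hodge sextuples⟩` (`Shioda1979.MPrime`). An ADDITIVE functional
`Φ_c(s) = Σ_{x ∈ s} c(x)` (`phi`, `c` a list of integers indexed by representatives) that vanishes on every generator vanishes on `M'ₘ`, so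
`Φ_c(s) ≠ 0` refutes `(Q⁴ₘ)` (`not_conditionQ_four_of_obstruction`). Vanishing on the generators is decided by kernel enumerations over
representatives with Shioda's Hodge test in `ℕ` arithmetic over `Shioda1982.unitsList` (`pairsB`; `checkFour` over `(a, b, c, −(a+b+c))`;
`checkSixRange` over the juxtapositions `(a, b, −(a+b), c, d, −(c+d))` of two zero-sum triples, sorted `a ≤ b`, `a ≤ c ≤ d`, chunked by `a`),
with soundness lemmas `phi_pair`, `phi_four`, `phi_semi`, `phi_mPrime`. The functionals themselves are found outside Lean
(`code/lit/q4/sepfunc.py`: rational null space of the generator matrix); the level certificates are the sibling files `ConditionQObstruction<Level>.lean`.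

No definition of a `Prop`, no named fact; nothing here concerns the truth of the Hodge conjecture for any `Xⁿₘ` — a failure of `(Q⁴ₘ)` says
only that Shioda's 1979 method (even in its stable form) does not reach all Hodge classes of `X⁴ₘ` ([Shioda1981FermatType], Appendix, for `m = 25`).

References: [Shioda1979HodgeFermat] T. Shioda, Math. Ann. 245 (1979) §4 pp. 183–184; [Shioda1981FermatType] T. Shioda, Math. Ann. 258 (1981),
Appendix pp. 78–79; [Shioda1979PJA] T. Shioda, Proc. Japan Acad. 55A (1979) §1 eqs. (2)–(3).
-/

namespace Summit.HodgeConjecture.FermatCycles.ConditionQObstruction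

open Multiset
open Literature.AlgebraicGeometry.HodgeTheory Literature.AlgebraicGeometry.HodgeTheory.FermatCharacter
open Literature.AlgebraicGeometry.Shioda1979 Literature.AlgebraicGeometry.Shioda1982

/-! ### The additive functional -/

/-- `Φ_c(s) = Σ_{x ∈ s} c[x]` for a coefficient list `c` indexed by representatives (missing entries read `0`). [folklore] -/
def phi (N : ℕ) (c : List ℤ) (s : Multiset (ZMod N)) : ℤ := (s.map fun x ↦ c.getD x.val 0).sum

/-- `Φ` is additive. [folklore] -/
theorem phi_add (N : ℕ) (c : List ℤ) (s t : Multiset (ZMod N)) : phi N c (s + t) = phi N c s + phi N c t := by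
  simp [phi, Multiset.map_add, Multiset.sum_add]

/-- `Φ(0) = 0`. [folklore] -/
theorem phi_zero (N : ℕ) (c : List ℤ) : phi N c 0 = 0 := by simp [phi]

/-! ### Booleans on representatives -/

/-- `c` is odd: `c[x] + c[−x] = 0` for `0 < x < N` (then `Φ_c` kills the pairs). [folklore] -/
def pairsB (N : ℕ) (c : List ℤ) : Bool :=
  (List.range N).all fun x ↦ x == 0 || c.getD x 0 + c.getD ((N - x) % N) 0 == 0

/-- Shioda's Hodge test for `(a, b, c, −(a+b+c))` in `ℕ` arithmetic (`d = (N − (a+b+c) % N) % N`). [cite: Shioda1979PJA, §1 eqs. (2), (3)] -/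
def hodgeFourN (N a b c : ℕ) : Bool :=
  (a != 0 && b != 0 && c != 0 && (N - (a + b + c) % N) % N != 0) &&
    (unitsList N).all fun t ↦ t * a % N + t * b % N + t * c % N + t * ((N - (a + b + c) % N) % N) % N == 2 * N

/-- Shioda's Hodge test for `(a, b, −(a+b), c, d, −(c+d))` in `ℕ` arithmetic. [cite: Shioda1979PJA, §1 eqs. (2), (3)] -/
def hodgeSixN (N a b c d : ℕ) : Bool :=
  (a != 0 && b != 0 && (N - (a + b) % N) % N != 0 && c != 0 && d != 0 && (N - (c + d) % N) % N != 0) &&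
    (unitsList N).all fun t ↦
      t * a % N + t * b % N + t * ((N - (a + b) % N) % N) % N + t * c % N + t * d % N + t * ((N - (c + d) % N) % N) % N == 3 * N

/-- The quadruple of residues. [folklore] -/
def quad (N a b c : ℕ) : Multiset (ZMod N) :=
  {(a : ZMod N), (b : ZMod N), (c : ZMod N), -((a : ZMod N) + (b : ZMod N) + (c : ZMod N))}

/-- The juxtaposition of the two zero-sum triples. [folklore] -/
def sext (N a b c d : ℕ) : Multiset (ZMod N) :=
  {(a : ZMod N), (b : ZMod N), -((a : ZMod N) + (b : ZMod N)), (c : ZMod N), (d : ZMod N), -((c : ZMod N) + (d : ZMod N))}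

/-- `Φ_c` vanishes on every Hodge `4`-multiset: enumeration over `(a, b, c) ∈ [0, N)³`. [cite: Shioda1979HodgeFermat, §4 p. 183 (Mₘ(2) ⊂ M'ₘ)] -/
def checkFour (N : ℕ) (c : List ℤ) : Bool :=
  (List.range N).all fun a ↦ (List.range N).all fun b ↦ (List.range N).all fun c' ↦
    !(hodgeFourN N a b c') || phi N c (quad N a b c') == 0

/-- `Φ_c` vanishes on every semi-decomposable Hodge sextuple with sorted representatives `a ≤ b`, `a ≤ c ≤ d`, for fixed `a`.
[cite: Shioda1979HodgeFermat, §4 p. 183 (Mₘ(3)^{sd} ⊂ M'ₘ)] -/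
def checkSix (N : ℕ) (c : List ℤ) (a : ℕ) : Bool :=
  (List.range' a (N - a)).all fun b ↦ (List.range' a (N - a)).all fun c' ↦ (List.range' c' (N - c')).all fun d ↦
    !(hodgeSixN N a b c' d) || phi N c (sext N a b c' d) == 0

/-- Chunk of first representatives `a ∈ [a₀, a₀ + len)`. [folklore] -/
def checkSixRange (N : ℕ) (c : List ℤ) (a0 len : ℕ) : Bool := (List.range' a0 len).all (checkSix N c)

/-! ### Soundness -/

/-- An odd `c` kills the pairs. [cite: Shioda1979HodgeFermat, §3 p. 180 (Mₘ(1))] -/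
theorem phi_pair {N : ℕ} [NeZero N] {c : List ℤ} (hp : pairsB N c = true) (a : ZMod N) (ha : a ≠ 0) :
    phi N c {a, -a} = 0 := by
  unfold pairsB at hp
  rw [List.all_eq_true] at hp
  have h := hp a.val (List.mem_range.mpr (ZMod.val_lt a))
  have ha' : (a.val == 0) = false := by
    rw [beq_eq_false_iff_ne]; exact fun e ↦ ha ((ZMod.val_eq_zero a).mp e)
  rw [ha', Bool.false_or, beq_iff_eq] at h
  have hneg : (-a).val = (N - a.val) % N := ZMod.neg_val' a
  simp only [phi, insert_eq_cons, map_cons, map_singleton, sum_cons, sum_singleton, hneg]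
  linarith

/-- A Hodge `4`-multiset `{a, b, c, −(a+b+c)}` passes `hodgeFourN` on its representatives. [cite: Shioda1979PJA, §1 eqs. (2), (3)] -/
theorem hodgeFourN_of_isHodgeMultiset {N : ℕ} [NeZero N] (a b c : ZMod N)
    (h : IsHodgeMultiset ({a, b, c, -(a + b + c)} : Multiset (ZMod N))) : hodgeFourN N a.val b.val c.val = true := by
  have hv : (-(a + b + c)).val = (N - (a.val + b.val + c.val) % N) % N := by
    rw [ZMod.neg_val', ZMod.val_add, ZMod.val_add, Nat.mod_add_mod]
  rw [isHodgeMultiset_iff_unitsList] at h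
  obtain ⟨⟨h0, -⟩, hall⟩ := h
  have ha : a.val ≠ 0 := fun e ↦ h0 a (by simp) ((ZMod.val_eq_zero a).mp e)
  have hb : b.val ≠ 0 := fun e ↦ h0 b (by simp) ((ZMod.val_eq_zero b).mp e)
  have hc : c.val ≠ 0 := fun e ↦ h0 c (by simp) ((ZMod.val_eq_zero c).mp e)
  have hd : (-(a + b + c)).val ≠ 0 := fun e ↦ h0 (-(a + b + c)) (by simp) ((ZMod.val_eq_zero _).mp e)
  rw [hv] at hd
  unfold hodgeFourN
  simp only [Bool.and_eq_true, bne_iff_ne, ne_eq, List.all_eq_true, beq_iff_eq]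
  refine ⟨⟨⟨⟨ha, hb⟩, hc⟩, hd⟩, fun t ht ↦ ?_⟩
  have := hall t ht
  simp only [Multiset.insert_eq_cons, Multiset.map_cons, Multiset.map_singleton, Multiset.sum_cons, Multiset.sum_singleton,
    Multiset.card_cons, Multiset.card_singleton, hv] at this
  omega

/-- A Hodge sextuple `{a, b, −(a+b), c, d, −(c+d)}` passes `hodgeSixN` on its representatives. [cite: Shioda1979PJA, §1 eqs. (2), (3)] -/
theorem hodgeSixN_of_isHodgeMultiset {N : ℕ} [NeZero N] (a b c d : ZMod N)
    (h : IsHodgeMultiset ({a, b, -(a + b), c, d, -(c + d)} : Multiset (ZMod N))) :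
    hodgeSixN N a.val b.val c.val d.val = true := by
  have hx : (-(a + b)).val = (N - (a.val + b.val) % N) % N := by rw [ZMod.neg_val', ZMod.val_add]
  have hy : (-(c + d)).val = (N - (c.val + d.val) % N) % N := by rw [ZMod.neg_val', ZMod.val_add]
  rw [isHodgeMultiset_iff_unitsList] at h
  obtain ⟨⟨h0, -⟩, hall⟩ := h
  have ha : a.val ≠ 0 := fun e ↦ h0 a (by simp) ((ZMod.val_eq_zero a).mp e)
  have hb : b.val ≠ 0 := fun e ↦ h0 b (by simp) ((ZMod.val_eq_zero b).mp e)
  have hc : c.val ≠ 0 := fun e ↦ h0 c (by simp) ((ZMod.val_eq_zero c).mp e)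
  have hd : d.val ≠ 0 := fun e ↦ h0 d (by simp) ((ZMod.val_eq_zero d).mp e)
  have hx0 : (-(a + b)).val ≠ 0 := fun e ↦ h0 (-(a + b)) (by simp) ((ZMod.val_eq_zero _).mp e)
  have hy0 : (-(c + d)).val ≠ 0 := fun e ↦ h0 (-(c + d)) (by simp) ((ZMod.val_eq_zero _).mp e)
  rw [hx] at hx0
  rw [hy] at hy0
  unfold hodgeSixN
  simp only [Bool.and_eq_true, bne_iff_ne, ne_eq, List.all_eq_true, beq_iff_eq]
  refine ⟨⟨⟨⟨⟨⟨ha, hb⟩, hx0⟩, hc⟩, hd⟩, hy0⟩, fun t ht ↦ ?_⟩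
  have := hall t ht
  simp only [Multiset.insert_eq_cons, Multiset.map_cons, Multiset.map_singleton, Multiset.sum_cons, Multiset.sum_singleton,
    Multiset.card_cons, Multiset.card_singleton, hx, hy] at this
  omega

/-- `quad` of the representatives is the multiset itself. [folklore] -/
theorem quad_val {N : ℕ} [NeZero N] (a b c : ZMod N) : quad N a.val b.val c.val = {a, b, c, -(a + b + c)} := by
  simp [quad]

/-- `sext` of the representatives is the multiset itself. [folklore] -/
theorem sext_val {N : ℕ} [NeZero N] (a b c d : ZMod N) : sext N a.val b.val c.val d.val = {a, b, -(a + b), c, d, -(c + d)} := by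
  simp [sext]

/-- **`Φ_c` vanishes on the Hodge `4`-multisets** when `checkFour` passes. [cite: Shioda1979HodgeFermat, §4 p. 183] -/
theorem phi_four {N : ℕ} [NeZero N] {c : List ℤ} (h4 : checkFour N c = true) (a b c' : ZMod N)
    (h : IsHodgeMultiset ({a, b, c', -(a + b + c')} : Multiset (ZMod N))) : phi N c {a, b, c', -(a + b + c')} = 0 := by
  unfold checkFour at h4
  rw [List.all_eq_true] at h4
  have ha := h4 a.val (List.mem_range.mpr (ZMod.val_lt a))
  rw [List.all_eq_true] at ha
  have hb := ha b.val (List.mem_range.mpr (ZMod.val_lt b))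
  rw [List.all_eq_true] at hb
  have hc := hb c'.val (List.mem_range.mpr (ZMod.val_lt c'))
  rw [quad_val, Bool.or_eq_true, Bool.not_eq_true', beq_iff_eq] at hc
  rcases hc with hc | hc
  · rw [hodgeFourN_of_isHodgeMultiset a b c' h] at hc; exact absurd hc (by decide)
  · exact hc

/-- The sorted case of `phi_semi`. [cite: Shioda1979HodgeFermat, §4 p. 183] -/
theorem phi_semi_sorted {N : ℕ} [NeZero N] {c : List ℤ} (chunks : List (ℕ × ℕ))
    (hcov : ∀ a, a < N → ∃ p ∈ chunks, p.1 ≤ a ∧ a < p.1 + p.2) (h6 : ∀ p ∈ chunks, checkSixRange N c p.1 p.2 = true)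
    (a b c' d : ZMod N) (hab : a.val ≤ b.val) (hac : a.val ≤ c'.val) (hcd : c'.val ≤ d.val)
    (h : IsHodgeMultiset ({a, b, -(a + b), c', d, -(c' + d)} : Multiset (ZMod N))) :
    phi N c {a, b, -(a + b), c', d, -(c' + d)} = 0 := by
  obtain ⟨p, hp, hp0, hp1⟩ := hcov a.val (ZMod.val_lt a)
  have hr := h6 p hp
  unfold checkSixRange at hr
  rw [List.all_eq_true] at hr
  have ha := hr a.val (List.mem_range'_1.mpr ⟨hp0, hp1⟩)
  unfold checkSix at ha
  rw [List.all_eq_true] at ha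
  have hav := ZMod.val_lt a
  have hbv := ZMod.val_lt b
  have hcv := ZMod.val_lt c'
  have hdv := ZMod.val_lt d
  have hb := ha b.val (List.mem_range'_1.mpr ⟨hab, by omega⟩)
  rw [List.all_eq_true] at hb
  have hc := hb c'.val (List.mem_range'_1.mpr ⟨hac, by omega⟩)
  rw [List.all_eq_true] at hc
  have hd := hc d.val (List.mem_range'_1.mpr ⟨hcd, by omega⟩)
  rw [sext_val, Bool.or_eq_true, Bool.not_eq_true', beq_iff_eq] at hd
  rcases hd with hd | hd
  · rw [hodgeSixN_of_isHodgeMultiset a b c' d h] at hd; exact absurd hd (by decide)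
  · exact hd

/-- Half-sorted case (sorted inside the triples), in the sum-of-triples form. [folklore] -/
theorem phi_semi_halfsorted {N : ℕ} [NeZero N] {c : List ℤ} (chunks : List (ℕ × ℕ))
    (hcov : ∀ a, a < N → ∃ p ∈ chunks, p.1 ≤ a ∧ a < p.1 + p.2) (h6 : ∀ p ∈ chunks, checkSixRange N c p.1 p.2 = true)
    (a b c' d : ZMod N) (hab : a.val ≤ b.val) (hcd : c'.val ≤ d.val)
    (h : IsHodgeMultiset (({a, b, -(a + b)} : Multiset (ZMod N)) + {c', d, -(c' + d)})) :
    phi N c (({a, b, -(a + b)} : Multiset (ZMod N)) + {c', d, -(c' + d)}) = 0 := by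
  rcases le_total a.val c'.val with hac | hca
  · have heq : (({a, b, -(a + b)} : Multiset (ZMod N)) + {c', d, -(c' + d)}) = {a, b, -(a + b), c', d, -(c' + d)} := by
      simp only [insert_eq_cons, ← singleton_add]; abel
    rw [heq] at h ⊢
    exact phi_semi_sorted chunks hcov h6 a b c' d hab hac hcd h
  · have heq : (({a, b, -(a + b)} : Multiset (ZMod N)) + {c', d, -(c' + d)}) = {c', d, -(c' + d), a, b, -(a + b)} := by
      simp only [insert_eq_cons, ← singleton_add]; abel
    rw [heq] at h ⊢
    exact phi_semi_sorted chunks hcov h6 c' d a b hcd hca hab h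

/-- **`Φ_c` vanishes on the semi-decomposable Hodge sextuples** (juxtapositions of two zero-sum triples) when the chunks of `checkSixRange`
cover `[0, N)`. [cite: Shioda1979HodgeFermat, §4 p. 183] -/
theorem phi_semi {N : ℕ} [NeZero N] {c : List ℤ} (chunks : List (ℕ × ℕ))
    (hcov : ∀ a, a < N → ∃ p ∈ chunks, p.1 ≤ a ∧ a < p.1 + p.2) (h6 : ∀ p ∈ chunks, checkSixRange N c p.1 p.2 = true)
    (a b c' d : ZMod N) (h : IsHodgeMultiset (({a, b, -(a + b)} : Multiset (ZMod N)) + {c', d, -(c' + d)})) :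
    phi N c (({a, b, -(a + b)} : Multiset (ZMod N)) + {c', d, -(c' + d)}) = 0 := by
  have hswap : ∀ x y : ZMod N, ({x, y, -(x + y)} : Multiset (ZMod N)) = {y, x, -(y + x)} := by
    intro x y; rw [add_comm y x]; simp [insert_eq_cons, cons_swap]
  rcases le_total a.val b.val with hab | hba <;> rcases le_total c'.val d.val with hcd | hdc
  · exact phi_semi_halfsorted chunks hcov h6 a b c' d hab hcd h
  · rw [hswap c' d] at h ⊢; exact phi_semi_halfsorted chunks hcov h6 a b d c' hab hdc h
  · rw [hswap a b] at h ⊢; exact phi_semi_halfsorted chunks hcov h6 b a c' d hba hcd h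
  · rw [hswap a b, hswap c' d] at h ⊢; exact phi_semi_halfsorted chunks hcov h6 b a d c' hba hdc h

/-- **`Φ_c` vanishes on `M'_N`** when it is odd and passes the two enumerations. [cite: Shioda1979HodgeFermat, §4 p. 183 (definition of M'ₘ)] -/
theorem phi_mPrime {N : ℕ} [NeZero N] {c : List ℤ} (hp : pairsB N c = true) (h4 : checkFour N c = true) (chunks : List (ℕ × ℕ))
    (hcov : ∀ a, a < N → ∃ p ∈ chunks, p.1 ≤ a ∧ a < p.1 + p.2) (h6 : ∀ p ∈ chunks, checkSixRange N c p.1 p.2 = true) :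
    ∀ ξ ∈ MPrime N, phi N c ξ = 0 := by
  intro ξ hξ
  induction hξ using AddSubmonoid.closure_induction with
  | mem g hg =>
    obtain ⟨hH, h2 | hq | ⟨-, t, u, ht3, hu3, hts, hus, rfl⟩⟩ := hg
    · obtain ⟨a, ha, rfl⟩ := hH.eq_pair_of_card_eq_two h2
      exact phi_pair hp a ha
    · obtain ⟨a, b, c', d, rfl⟩ := Multiset.card_eq_four.mp hq
      have hd : d = -(a + b + c') := by
        have h0 := hH.1.2
        simp only [insert_eq_cons, sum_cons, sum_singleton] at h0
        linear_combination h0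
      subst hd
      exact phi_four h4 a b c' hH
    · obtain ⟨a, b, x, rfl⟩ := Multiset.card_eq_three.mp ht3
      obtain ⟨c', d, y, rfl⟩ := Multiset.card_eq_three.mp hu3
      have hx : x = -(a + b) := by
        simp only [insert_eq_cons, sum_cons, sum_singleton] at hts; linear_combination hts
      have hy : y = -(c' + d) := by
        simp only [insert_eq_cons, sum_cons, sum_singleton] at hus; linear_combination hus
      subst hx hy
      exact phi_semi chunks hcov h6 a b c' d hH
  | zero => exact phi_zero N c
  | add x y _ _ hx hy => rw [phi_add, hx, hy, add_zero]

/-- **The obstruction.** If `Φ_c` is odd and vanishes on all Hodge `4`-multisets and all semi-decomposable Hodge sextuples (kernel checks),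
then a Hodge sextuple `s` with `Φ_c(s) ≠ 0` is not `ξ₁ − ξ₂` with `ξᵢ ∈ M'_N`: `(Q⁴_N)` fails. (Shioda's argument for `m = 25`,
[Shioda1981FermatType] Appendix, with a general additive invariant.) [cite: Shioda1979HodgeFermat, §4 condition (Qⁿₘ), pp. 183–184] -/
theorem not_conditionQ_four_of_obstruction {N : ℕ} [NeZero N] {c : List ℤ} (hp : pairsB N c = true) (h4 : checkFour N c = true)
    (chunks : List (ℕ × ℕ)) (hcov : ∀ a, a < N → ∃ p ∈ chunks, p.1 ≤ a ∧ a < p.1 + p.2)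
    (h6 : ∀ p ∈ chunks, checkSixRange N c p.1 p.2 = true)
    (s : Multiset (ZMod N)) (hs : IsHodgeMultiset s) (hcard : card s = 6) (hphi : phi N c s ≠ 0) : ¬ ConditionQ N 4 := by
  intro hQ
  obtain ⟨ξ₁, h₁, ξ₂, h₂, heq⟩ := hQ s hs (by omega) (by omega)
  have e1 := phi_mPrime hp h4 chunks hcov h6 ξ₁ h₁
  have e2 := phi_mPrime hp h4 chunks hcov h6 ξ₂ h₂
  rw [← heq, phi_add, e2, add_zero] at e1
  exact hphi e1

end Summit.HodgeConjecture.FermatCycles.ConditionQObstruction
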